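import Literature.NumberTheory.LFunctions.WeilChirpRemainder
import HarnessLib

/-!
# `stub_chirp`: exact Poisson–Euler–Maclaurin bookkeeping of a super-Nyquist half-chirp

Registered stub `stub_chirp` of the line `anchor-float` of the crux
`Summit.RiemannHypothesis.RiemannHypothesis.Theses.SpectralTrace.WindowTracePrime2`
(stmt-RiemannHypothesis-11196). For a chirp phase `φ` (`φ' ≥ log 3/(2π) + δ` and symbol bounds
`|φ^{(j)}(t)| ≤ C_j t^{1-j} log(t+2)` on `[H, ∞)`, `φ(H) = 0`) with level points `φ(γ_n) = n`,
there is a smooth `A`, independent of the test function, such that for every Weil test `g`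
supported in the window `[-log 3, log 3]`
`Σ_{±} Σ_n ĝ(1/2 ± iγ_n) = ∫_{t>H} (ĝ(1/2+it) + ĝ(1/2-it)) φ'(t) dt + ∫ g A`
as a `HasSum` over `ℕ ⊕ ℕ`.

Proof: with `h(x) = g(x) + g(-x)` and `F(t) = ĥ(1/2+it) = ĝ(1/2+it) + ĝ(1/2-it)`, the
second-order Euler–Maclaurin formula along the level set
(`Literature.Analysis.Fourier.ChirpPhase.tendsto_sum_range_level`) gives
`Σ_{n<N} F(γ_n) → ½F(H) + ∫_{t>H} Fφ' − ∫_{t>H} W P(φ)`; the remainder `½F(H) − ∫ W P(φ)` is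
`∫ h Ψ` for a smooth `Ψ` (`Literature.NumberTheory.LFunctions.exists_weil_chirp_remainder_kernel`:
near part, non-stationary alias kernels for the modes `k ≠ 0` — `|x| ≤ log 3 < 2πkφ'` — and the
mean mode), `∫ h Ψ = ∫ g (Ψ + Ψ(-·))`, and both half-sums converge absolutely
(`‖ĝ(1/2 ± it)‖ ≤ D/(1+t²)²`, `n ≤ C(1+γ_n²)`).
-/

set_option linter.dupNamespace false

noncomputable section

open Complex Filter Set MeasureTheory
open scoped Real Topology ContDiff

namespace Summit.RiemannHypothesis.RiemannHypothesis.Theorems.AnchorFloat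

open Literature.NumberTheory.LFunctions Literature.Analysis.Fourier

/-- **`stub_chirp`** (line `anchor-float`, crux `WindowTracePrime2`): exact Poisson /
Euler–Maclaurin bookkeeping of a symmetric super-Nyquist half-chirp — the family `±γ_n`,
`φ(γ_n) = n`, reproduces `∫_{t>H} (ĝ(1/2+it) + ĝ(1/2-it)) φ'(t) dt` exactly up to `∫ g A` with
`A` smooth and independent of the window test function `g`. [folklore] -/
theorem stub_chirp :
    ∀ (φ : ℝ → ℝ) (H δ : ℝ) (Cφ : ℕ → ℝ) (γ : ℕ → ℝ), 1 ≤ H → 0 < δ → ContDiff ℝ ∞ φ → φ H = 0 →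
      (∀ t, H ≤ t → Real.log 3 / (2 * Real.pi) + δ ≤ deriv φ t) →
      (∀ (j : ℕ) (t : ℝ), 1 ≤ j → H ≤ t →
        |iteratedDeriv j φ t| ≤ Cφ j * t ^ (1 - (j : ℝ)) * Real.log (t + 2)) →
      (∀ n, H ≤ γ n ∧ φ (γ n) = n) →
      ∃ A : ℝ → ℂ, ContDiff ℝ ∞ A ∧
        ∀ g : ℝ → ℂ, Literature.NumberTheory.LFunctions.IsWeilTest g →
          tsupport g ⊆ Set.Icc (-Real.log 3) (Real.log 3) →
          HasSum (fun p : ℕ ⊕ ℕ =>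
              Literature.NumberTheory.LFunctions.weilMellin g
                (1 / 2 + ((Sum.elim γ (fun n => -γ n) p : ℝ) : ℂ) * Complex.I))
            ((∫ t in Set.Ioi H,
                (Literature.NumberTheory.LFunctions.weilMellin g (1 / 2 + (t : ℂ) * Complex.I) +
                  Literature.NumberTheory.LFunctions.weilMellin g (1 / 2 - (t : ℂ) * Complex.I)) *
                ((deriv φ t : ℝ) : ℂ)) + ∫ u, g u * A u) := by
  intro φ H δ Cφ γ hH hδ hφs hφH hder hsymb hγ
  set L : ℝ := Real.log 3 / (2 * Real.pi) + δ with hL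
  have hlog3 : 0 < Real.log 3 := Real.log_pos (by norm_num)
  have hLpos : 0 < L := by rw [hL]; positivity
  have hφ : ChirpPhase φ H L Cφ := ⟨hH, hLpos, hφs, hder, hsymb⟩
  obtain ⟨Ψ, hΨ, hΨid⟩ := exists_weil_chirp_remainder_kernel hφ hδ hL hφH
  refine ⟨fun u => Ψ u + Ψ (-u), hΨ.add (hΨ.comp contDiff_neg), fun g hg hga => ?_⟩
  have hgc : Continuous g := hg.1.continuous
  -- the even part and its transforms
  have hh : IsWeilTest fun x : ℝ => g x + g (-x) :=
    ⟨hg.1.add (hg.1.comp contDiff_neg), hg.2.add hg.comp_neg.2⟩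
  have hha : tsupport (fun x : ℝ => g x + g (-x)) ⊆ Icc (-Real.log 3) (Real.log 3) :=
    tsupport_add_comp_neg_subset hga
  have hF : ∀ t : ℝ, HasDerivAt (fun t : ℝ => weilMellin (fun x : ℝ => g x + g (-x)) (1 / 2 + t * I))
      (weilMellin (fun x : ℝ => I * x * (g x + g (-x))) (1 / 2 + t * I)) t :=
    hasDerivAt_weilMellin_line hh
  have hF₁ : ∀ t : ℝ, HasDerivAt
      (fun t : ℝ => weilMellin (fun x : ℝ => I * x * (g x + g (-x))) (1 / 2 + t * I))
      (weilMellin (fun x : ℝ => I * x * (I * x * (g x + g (-x)))) (1 / 2 + t * I)) t :=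
    hasDerivAt_weilMellin_line hh.I_mul
  have hF₂c : Continuous fun t : ℝ =>
      weilMellin (fun x : ℝ => I * x * (I * x * (g x + g (-x)))) (1 / 2 + t * I) :=
    continuous_weilMellin_line hh.I_mul.I_mul
  -- the Euler–Maclaurin limit along the level set
  have hlim := hφ.tendsto_sum_range_level hF hF₁ hF₂c hφH hγ
    (integrableOn_weilMellin_line_mul_chirp_deriv hφ hh)
    (integrableOn_emW_weilMellin_mul_perB2 hφ hh.I_mul) (tendsto_weilMellin_line_zero hh)
  -- the remainder and its symmetrisation
  have hrem := hΨid _ hh hha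
  have hsym : ∫ x, (g x + g (-x)) * Ψ x = ∫ u, g u * (Ψ u + Ψ (-u)) :=
    integral_add_comp_neg_mul hgc hg.2 hΨ.continuous
  -- `F(t) = ĝ(1/2+it) + ĝ(1/2-it)`
  have hFt : ∀ t : ℝ, weilMellin (fun x : ℝ => g x + g (-x)) (1 / 2 + t * I) =
      weilMellin g (1 / 2 + t * I) + weilMellin g (1 / 2 - t * I) := fun t => by
    have := weilMellin_add (h := fun t : ℝ => g (-t)) hgc hg.2 (hgc.comp continuous_neg)
      hg.comp_neg.2 (1 / 2 + t * I)
    rw [weilMellin_comp_neg_half] at this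
    exact this
  -- absolute convergence of the two half sums
  obtain ⟨C, hC, hgrowth⟩ := hφ.exists_level_growth hφH hγ
  obtain ⟨D, _, hD⟩ := exists_norm_weilMellin_line_le hg
  have hs1 : Summable fun n : ℕ => weilMellin g (1 / 2 + (γ n : ℂ) * I) :=
    summable_of_level_growth hC (fun n => hD (γ n)) hgrowth
  have hs2 : Summable fun n : ℕ => weilMellin g (1 / 2 + ((-γ n : ℝ) : ℂ) * I) :=
    summable_of_level_growth hC (fun n => by simpa [neg_sq] using hD (-γ n)) hgrowth
  -- the partial sums of `F(γ_n)` and their limit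
  have hlim2 : Tendsto (fun N => ∑ n ∈ Finset.range N,
      weilMellin (fun x : ℝ => g x + g (-x)) (1 / 2 + (γ n : ℂ) * I)) atTop
      (𝓝 ((∑' n, weilMellin g (1 / 2 + (γ n : ℂ) * I)) +
        ∑' n, weilMellin g (1 / 2 + ((-γ n : ℝ) : ℂ) * I))) := by
    have heq : (fun N => ∑ n ∈ Finset.range N,
        weilMellin (fun x : ℝ => g x + g (-x)) (1 / 2 + (γ n : ℂ) * I)) =
        fun N => (∑ n ∈ Finset.range N, weilMellin g (1 / 2 + (γ n : ℂ) * I)) +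
          ∑ n ∈ Finset.range N, weilMellin g (1 / 2 + ((-γ n : ℝ) : ℂ) * I) := by
      funext N
      rw [← Finset.sum_add_distrib]
      refine Finset.sum_congr rfl fun n _ => ?_
      rw [hFt, weilMellin_half_neg]
    rw [heq]
    exact hs1.hasSum.tendsto_sum_nat.add hs2.hasSum.tendsto_sum_nat
  have hval := tendsto_nhds_unique hlim2 hlim
  -- assemble
  have hsum := HasSum.sum (f := fun p : ℕ ⊕ ℕ =>
    weilMellin g (1 / 2 + ((Sum.elim γ (fun n => -γ n) p : ℝ) : ℂ) * I)) hs1.hasSum hs2.hasSum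
  rw [hval] at hsum
  have hmain : ∫ t in Ioi H, weilMellin (fun x : ℝ => g x + g (-x)) (1 / 2 + t * I) *
      ((deriv φ t : ℝ) : ℂ) = ∫ t in Ioi H, (weilMellin g (1 / 2 + (t : ℂ) * I) +
        weilMellin g (1 / 2 - (t : ℂ) * I)) * ((deriv φ t : ℝ) : ℂ) :=
    integral_congr_ae (Eventually.of_forall fun t => by simp only [hFt])
  convert hsum using 1
  rw [← hmain, ← hsym, ← hrem]
  ring

end Summit.RiemannHypothesis.RiemannHypothesis.Theorems.AnchorFloat
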